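import Summits.CriticalPhenomena.Ising3DConformalLimit.Theses.PrimaryAtInfinity
import Summits.CriticalPhenomena.Ising3DConformalLimit.Theorems.PrecisionLaplacianMoebiusLimitOfTwoPointLawFarFieldCoeffContinuous
import Summits.CriticalPhenomena.Ising3DConformalLimit.Theorems.PrecisionLaplacianMoebiusLimitOfTwoPointLawMultipoleToWardOfContinuous
import HarnessLib

/-!
# Item stmt-CriticalPhenomena-5356 `PrimaryAtInfinity.MultipoleToWard` — first multipole at infinity gives the weak
# special-conformal Ward identity (line `multipole-ward-nonsat-endpoint` of crux `MoebiusLimitOfTwoPointLaw`, item 4801)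

`multipoleToWard : PrimaryAtInfinity.MultipoleToWard`: if every `S_n` is continuous off the diagonals, `c ≠ 0`, and for
every `n` there are far-field coefficients `(A₀, A₁)` of `S_{n+2}` with the first-order far-field expansion, the
first-multipole identity at level `n+1` and monopole/dipole clustering at level `n`, then every `S_n` satisfies the weak
special-conformal Ward identity with weight `Δ`.

Proof = the two landed stubs of the line: `stub_farFieldCoeffContinuous` (p97822: the expansion forces `A₀, A₁` to be
continuous off the diagonals) feeds `stub_multipoleToWardOfContinuous` (the `φ(x)χ_L(z)`, `L → ∞` argument with an
even annular bump and honest Fubini).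

References: Di Francesco–Mathieu–Sénéchal 1997 §4.2–4.3 [FrancescoMathieuSenechal1997]; Hörmander, ALPDO I
[HormanderALPDO1].
-/

noncomputable section

namespace Summit.CriticalPhenomena.Ising3DConformalLimit.PrecisionLaplacianMoebiusLimitOfTwoPointLaw

open Literature.Probability.LatticeModels
open Summit.CriticalPhenomena.Ising3DConformalLimit.Theses

/-- **Item 5356 `PrimaryAtInfinity.MultipoleToWard`.** First-multipole identity + monopole/dipole clustering (with
the far-field expansion clause) ⇒ the weak special-conformal Ward identity for every `S_n`; composition of
`stub_farFieldCoeffContinuous` (continuity of the coefficients) and `stub_multipoleToWardOfContinuous` (the analysis). -/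
theorem multipoleToWard : PrimaryAtInfinity.MultipoleToWard := by
  intro S c Δ hc hcont hFF
  refine stub_multipoleToWardOfContinuous S c Δ hc hcont fun m => ?_
  obtain ⟨A₀, A₁, hE, hI, hM, hD⟩ := hFF m
  have hA := stub_farFieldCoeffContinuous S Δ m A₀ A₁ hcont hE
  exact ⟨A₀, A₁, hA.1, hA.2, hI, hM, hD⟩

end Summit.CriticalPhenomena.Ising3DConformalLimit.PrecisionLaplacianMoebiusLimitOfTwoPointLaw

end
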